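import Mathlib.LinearAlgebra.Dimension.Finite
import Literature.Topology.FourManifolds.LeeRasmussenRankProofs
import HarnessLib

/-!
# Lee's theorem off degree zero: `Kh'ⁱ = 0` for `i ≠ 0` (reduction to the merge/split dichotomy)

Sibling file of `LeeRasmussen.lean`, companion of `LeeRasmussenRankProofs`. Main result:

* `isZero_leeHomology_of_ne_zero_of_dichotomy` — **the named fact `isZero_leeHomology_of_ne_zero`
  (Lee (2005), Thm. 4.2 with Prop. 4.3: for a knot both generators of Lee homology live in the
  homological degree of the oriented resolution, so `Kh'ⁱ(K) = 0` for `i ≠ 0`; Rasmussen (2010),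
  Prop. 2.3/§2.3) follows from the named fact `isMergeAt_or_isSplitAt_of_hasGaussDiagram`** of
  `KhResolutions` (the planarity input). The contraction `D H + H D = 1 - Π` of
  `LeeRasmussenContractionProofs` holds in every degree `k`; the projector `Π_k` onto the
  generators with no free chord vanishes for `k ≠ 0`, because such generators are Lee's
  canonical states over the Seifert resolution, of degree `0` (`isEmpty_noFree_degStates`), so
  `dim Kh'ᵏ = rank Π_k = 0`.

## References

* E. S. Lee, *An endomorphism of the Khovanov invariant*, Adv. Math. 197 (2005) 554–586,
  Thm. 4.2, Prop. 4.3. [cite: Lee2005, Thm. 4.2]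
* J. Rasmussen, *Khovanov homology and the slice genus*, Invent. Math. 182 (2010), Prop. 2.3,
  §2.3. [cite: Rasmussen2010, §2.3]
-/

open Function Set Matrix CategoryTheory

noncomputable section

namespace Literature.Topology.FourManifolds

namespace GaussDiagram

variable {G : GaussDiagram}

/-- **Generators with no free chord live in degree `0`.** Under Gauss parity of the chords, an
enhanced state whose labelling has no free chord lies over the Seifert (oriented) resolution
(`isAlternating_of_forall_not_free`, `isSeifert_of_isAlternating`), hence has homological
degree `0` (`weight_seifertState`). Lee (2005), Prop. 4.3 (for a knot the canonical generators
sit in the degree of the oriented resolution). [cite: Lee2005, Prop. 4.3] -/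
theorem homDegree_eq_zero_of_forall_not_free
    (hpar : ∀ i : Fin G.n, (G.overPos i).val % 2 ≠ (G.underPos i).val % 2)
    (s : G.EnhancedState) (hf : ∀ i, ¬ G.Free s.label i) : homDegree s = 0 := by
  have ha : G.IsAlternating s.label := isAlternating_of_forall_not_free s.isLabelOf hf
  have hσ : s.state = G.seifertState :=
    eq_seifertState_of_forall fun i ↦ isSeifert_of_isAlternating s.isLabelOf ha (hpar i)
  rw [homDegree, hσ, weight_seifertState]
  simp

/-- In a nonzero degree no generator has a labelling without free chord (under Gauss parity).
[cite: Lee2005, Prop. 4.3] -/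
theorem isEmpty_noFree_degStates
    (hpar : ∀ i : Fin G.n, (G.overPos i).val % 2 ≠ (G.underPos i).val % 2) {k : ℤ} (hk : k ≠ 0) :
    IsEmpty {s : G.degStates k // ∀ i, ¬ G.Free s.1.label i} :=
  ⟨fun s ↦ hk (s.1.2.symm.trans (homDegree_eq_zero_of_forall_not_free hpar s.1.1 s.2))⟩

/-- The projector onto Lee's canonical generators vanishes off degree `0` (given the
merge/split dichotomy, through Gauss parity). [cite: Lee2005, Thm. 4.2] -/
theorem finrank_range_leeProjMat_eq_zero
    (hD : ∀ (σ : G.State) (i : Fin G.n), σ i = false → G.IsMergeAt σ i ∨ G.IsSplitAt σ i)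
    {k : ℤ} (hk : k ≠ 0) :
    Module.finrank ℚ (LinearMap.range (Matrix.toLin' (G.leeProjMat k))) = 0 := by
  classical
  have hpar : ∀ i : Fin G.n, (G.overPos i).val % 2 ≠ (G.underPos i).val % 2 :=
    overPos_mod_two_ne_of_dichotomy hD
  have h1 : Module.finrank ℚ (LinearMap.range (Matrix.toLin' (G.leeProjMat k))) =
      (G.leeProjMat k).rank := by
    rw [Matrix.rank, Matrix.toLin'_apply']
  rw [h1, leeProjMat, Matrix.rank_diagonal, Fintype.card_eq_zero_iff]
  haveI := isEmpty_noFree_degStates (G := G) hpar hk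
  refine ⟨fun s ↦ IsEmpty.false (⟨s.1, fun i hfi ↦ ?_⟩ :
    {s : G.degStates k // ∀ i, ¬ G.Free s.1.label i})⟩
  by_cases h : ∀ i, ¬ G.Free s.1.1.label i
  · exact h i hfi
  · exact s.2 (if_neg h)

/-- `d² = 0` for Lee's differential in the indexing `(k - 1, k, k + 1)` (from
`khovanovD_comp_khovanovD_of_isMergeAt_or_isSplitAt`, stated for `(i, i + 1, i + 1 + 1)`).
[folklore] -/
theorem khovanovD_comp_khovanovD_pred
    (hD : ∀ (σ : G.State) (i : Fin G.n), σ i = false → G.IsMergeAt σ i ∨ G.IsSplitAt σ i)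
    (k : ℤ) : G.khovanovD ℚ 0 1 k (k + 1) ∘ₗ G.khovanovD ℚ 0 1 (k - 1) k = 0 := by
  have key : ∀ a b c : ℤ, b = a + 1 → c = a + 1 + 1 →
      G.khovanovD ℚ 0 1 b c ∘ₗ G.khovanovD ℚ 0 1 a b = 0 := by
    rintro a b c rfl rfl
    exact khovanovD_comp_khovanovD_of_isMergeAt_or_isSplitAt G ℚ hD 0 1 a
  exact key (k - 1) k (k + 1) (by ring) (by ring)

/-- **Lee's theorem off degree zero, from the merge/split dichotomy.** If every edge of the
cube of resolutions of every realisable Gauss diagram is a merge or a split (the named fact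
`isMergeAt_or_isSplitAt_of_hasGaussDiagram`, for all `G`), then Lee homology of a realisable
Gauss diagram vanishes in every homological degree `k ≠ 0` (the named fact
`isZero_leeHomology_of_ne_zero`): by the contraction `D H + H D = 1 - Π`
(`leeDiffMat_mul_leeHtpyMat_add`) and `finrank_ker_quotient_eq_of_homotopy`,
`dim Kh'ᵏ = rank Π_k = 0` (`finrank_range_leeProjMat_eq_zero`). Lee (2005), Thm. 4.2,
Prop. 4.3; Rasmussen (2010), Prop. 2.3. [cite: Lee2005, Thm. 4.2] -/
theorem isZero_leeHomology_of_ne_zero_of_dichotomy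
    (hD : ∀ G : GaussDiagram, isMergeAt_or_isSplitAt_of_hasGaussDiagram (G := G)) :
    isZero_leeHomology_of_ne_zero := by
  intro G hG k hk
  have hms : ∀ (σ : G.State) (i : Fin G.n), σ i = false → G.IsMergeAt σ i ∨ G.IsSplitAt σ i :=
    fun _ _ h ↦ hD G hG h
  set Ψm := G.leeCoord (k - 1) with hΨm
  set Ψ₀ := G.leeCoord k with hΨ₀
  set Ψp := G.leeCoord (k + 1) with hΨp
  set A := G.khovanovD ℚ 0 1 (k - 1) k with hA
  set B := G.khovanovD ℚ 0 1 k (k + 1) with hB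
  set h₀ : (G.degStates k → ℚ) →ₗ[ℚ] (G.degStates (k - 1) → ℚ) :=
    Ψm.symm.toLinearMap ∘ₗ Matrix.toLin' (G.leeHtpyMat k (k - 1)) ∘ₗ Ψ₀.toLinearMap with hh₀
  set h₁ : (G.degStates (k + 1) → ℚ) →ₗ[ℚ] (G.degStates k → ℚ) :=
    Ψ₀.symm.toLinearMap ∘ₗ Matrix.toLin' (G.leeHtpyMat (k + 1) k) ∘ₗ Ψp.toLinearMap with hh₁
  set π : (G.degStates k → ℚ) →ₗ[ℚ] (G.degStates k → ℚ) :=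
    Ψ₀.symm.toLinearMap ∘ₗ Matrix.toLin' (G.leeProjMat k) ∘ₗ Ψ₀.toLinearMap with hπ
  have hBA : B ∘ₗ A = 0 := khovanovD_comp_khovanovD_pred hms k
  have hh : ∀ x, A (h₀ x) + h₁ (B x) = x - π x := by
    intro x
    simp only [hh₀, hh₁, hπ, hA, hB, LinearMap.coe_comp, Function.comp_apply,
      LinearEquiv.coe_coe]
    rw [khovanovD_leeCoord_symm, leeCoord_khovanovD, ← map_add, ← Matrix.toLin'_mul_apply,
      ← Matrix.toLin'_mul_apply, ← LinearMap.add_apply, ← map_add,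
      leeDiffMat_mul_leeHtpyMat_add hms k, map_sub, Matrix.toLin'_one, LinearMap.sub_apply,
      LinearMap.id_apply, map_sub, LinearEquiv.symm_apply_apply]
  have hπA : ∀ y, π (A y) = 0 := by
    intro y
    simp only [hπ, hA, LinearMap.coe_comp, Function.comp_apply, LinearEquiv.coe_coe]
    rw [leeCoord_khovanovD, ← Matrix.toLin'_mul_apply, leeProjMat_mul_leeDiffMat, map_zero,
      LinearMap.zero_apply, map_zero]
  have hBπ : ∀ x, B (π x) = 0 := by
    intro x
    simp only [hπ, hB, LinearMap.coe_comp, Function.comp_apply, LinearEquiv.coe_coe]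
    rw [khovanovD_leeCoord_symm, ← Matrix.toLin'_mul_apply, leeDiffMat_mul_leeProjMat, map_zero,
      LinearMap.zero_apply, map_zero]
  have hππ : ∀ x, π (π x) = π x := by
    intro x
    simp only [hπ, LinearMap.coe_comp, Function.comp_apply, LinearEquiv.coe_coe]
    rw [LinearEquiv.apply_symm_apply, ← Matrix.toLin'_mul_apply, leeProjMat_mul_leeProjMat]
  have hrank : Module.finrank ℚ (LinearMap.range π) = 0 := by
    have hr : LinearMap.range π =
        (LinearMap.range (Matrix.toLin' (G.leeProjMat k))).map Ψ₀.symm.toLinearMap := by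
      rw [hπ, LinearMap.range_comp, LinearMap.range_comp, LinearEquiv.range, Submodule.map_top]
    rw [hr, LinearEquiv.finrank_map_eq]
    exact finrank_range_leeProjMat_eq_zero hms hk
  have hfin : Module.finrank ℚ (↥(LinearMap.ker B) ⧸
      (LinearMap.range A).comap (LinearMap.ker B).subtype) = 0 := by
    rw [finrank_ker_quotient_eq_of_homotopy A B h₀ h₁ π hBA hh hπA hBπ hππ, hrank]
  have hsub : Subsingleton (↥(LinearMap.ker B) ⧸
      (LinearMap.range A).comap (LinearMap.ker B).subtype) := Module.finrank_zero_iff.1 hfin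
  exact @ModuleCat.isZero_of_subsingleton ℚ _ (G.leeHomology k) hsub

end GaussDiagram

end Literature.Topology.FourManifolds
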